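import Mathlib
import Summits.NavierStokesRegularity.NavierStokesRegularity.Theorems.ScaledTopAlignmentDirectionGradientSelection
import HarnessLib

/-!
# Route `ScaledTopAlignment`: slice selection under a square-integrable majorant OFF an exceptional
# time set of final density `< 1` (tool for the MOST-TIMES form of Giga–Miura 2011, Cor. 2.6;
# support for the deciding crux W3ᵐᵗ = `AprioriMostTimesBulkAlignment`, stmt-NavierStokesRegularity-19551;
# no import of the route file)

The route's door W3ᵐᵗ demands its window clause only at times OUTSIDE an exceptional set `E` of final
density `≤ θ < 1` at `T` (`volume (E ∩ (T − h, T)) ≤ θ h` for small `h`). To run the Type-I zoom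
proof of Giga–Miura's direction-gradient criterion (`ScaledTopAlignmentGigaMiuraDirectionGradient`)
under such a hypothesis one needs, at every large zoom index `j`, a slice `σ_j` in a fixed compact
slice interval whose physical time `T + λ_j² σ_j/ν` avoids `E` AND at which the scaled majorant
`λ_j g(T + λ_j² σ_j/ν)` is small. This module proves exactly that
(`exists_slices_notMem_sq_le_of_sqIntegrable`): with `[a, b]` long enough (`θ|a| < b − a`,
`a = N b`), the scaled majorants `H_j(s) = λ_j g(T + λ_j² s/ν)` have `∫_{(a,b)} H_j² =: I_j → 0`
(affine substitution + absolute continuity, as in `exists_slice_frequently_lt_of_sqIntegrable`),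
Markov's inequality bounds the measure of `{H_j² ≥ δ_j}` by `ℓ/4` for `δ_j = I_j/(ℓ/4) + λ_j → 0`,
the density bound — pulled back to slice time by the affine covariance of Lebesgue measure
(`Real.volume_preimage_mul_left`, `measure_preimage_add`) — bounds the measure of
`{s : T + λ_j² s/ν ∈ E}` by `θ|a|`, and `θ|a| + ℓ/4 < b − a` leaves a good slice.
WHAT THIS IS NOT: not NS regularity; measure theory only.

## References
* Y. Giga, H. Miura, Comm. Math. Phys. 303 (2011) 289–300 = HUPS #956: Cor. 2.6 (p. 9). [GigaMiura2011]
-/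

noncomputable section

-- the summit and its single sub-problem share the name (CONVENTIONS §1), as in every Theorems file
set_option linter.dupNamespace false

open MeasureTheory Set Function Filter Topology Metric
open scoped RealInnerProductSpace ENNReal NNReal

namespace Summit.NavierStokesRegularity.NavierStokesRegularity.Theorems

open Literature.Analysis Literature.Analysis.FluidPDE

set_option maxHeartbeats 800000 in
/-- **Slice selection off an exceptional time set.** Let `g : ℝ → [0, ∞]` be measurable with
`∫_{(0,T)} g² < ∞` (`T > 0`, `ν > 0`), let `λ_j > 0`, `λ_j → 0`, let `E ⊆ ℝ` have final density
`≤ θ` at `T` (`volume (E ∩ (T−h, T)) ≤ θ h` for `0 < h < h₀`; `θ < 1`), and let `b < 0`. Then for some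
`a < b` there are slices `σ_j ∈ (a, b)` and bounds `δ_j → 0` such that, for all large `j`, the physical
time `T + λ_j² σ_j/ν` is NOT in `E` and `(λ_j g(T + λ_j² σ_j/ν))² ≤ δ_j` (Markov on
`∫_{(a,b)} λ_j² g(T + λ_j² s/ν)² ds → 0` plus the density bound pulled back to slice time). [folklore] -/
theorem exists_slices_notMem_sq_le_of_sqIntegrable {ν T θ : ℝ} (hν : 0 < ν) (hT : 0 < T) (hθ : θ < 1)
    {g : ℝ → ℝ≥0∞} (hgm : Measurable g) (hg2 : (∫⁻ t in Ioo 0 T, g t ^ 2) < ∞)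
    {lam : ℕ → ℝ} (hlam : ∀ j, 0 < lam j) (hlam0 : Tendsto lam atTop (𝓝 0))
    {E : Set ℝ} (hE : ∃ h0 : ℝ, 0 < h0 ∧ ∀ h : ℝ, 0 < h → h < h0 →
      volume (E ∩ Ioo (T - h) T) ≤ ENNReal.ofReal (θ * h))
    {b : ℝ} (hb : b < 0) :
    ∃ a : ℝ, a < b ∧ ∃ σ : ℕ → ℝ, ∃ δ : ℕ → ℝ≥0∞, Tendsto δ atTop (𝓝 0) ∧
      ∀ᶠ j in atTop, σ j ∈ Ioo a b ∧ T + lam j ^ 2 / ν * σ j ∉ E ∧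
        (ENNReal.ofReal (lam j) * g (T + lam j ^ 2 / ν * σ j)) ^ 2 ≤ δ j := by
  classical
  obtain ⟨h0, hh0, hE⟩ := hE
  -- the non-negative density fraction `θ' = max θ 0` and the slice interval `[a, b]`, `a = N b`
  set θ' : ℝ := max θ 0 with hθ'def
  have hθ'0 : 0 ≤ θ' := le_max_right _ _
  have hθ'1 : θ' < 1 := max_lt hθ one_pos
  have hE' : ∀ h : ℝ, 0 < h → h < h0 → volume (E ∩ Ioo (T - h) T) ≤ ENNReal.ofReal (θ' * h) :=
    fun h hh hh' => (hE h hh hh').trans (ENNReal.ofReal_le_ofReal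
      (mul_le_mul_of_nonneg_right (le_max_left _ _) hh.le))
  set B : ℝ := -b with hBdef
  have hB : 0 < B := by rw [hBdef]; linarith
  have h1θ : 0 < 1 - θ' := by linarith
  set N : ℝ := 2 / (1 - θ') + 1 with hNdef
  have hN1 : 1 < N := by
    have : 0 < 2 / (1 - θ') := div_pos two_pos h1θ
    rw [hNdef]; linarith
  set a : ℝ := N * b with hadef
  have hab : a < b := by rw [hadef]; nlinarith
  have hma : 0 < -a := by nlinarith
  set ℓ : ℝ := (b - a) - θ' * (-a) with hℓdef
  have hℓ : 0 < ℓ := by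
    have hNθ : N * (1 - θ') = 3 - θ' := by rw [hNdef]; field_simp; ring
    have e : ℓ = B * (2 - θ') := by
      rw [hℓdef, hadef, hBdef]; linear_combination (-b) * hNθ
    rw [e]; exact mul_pos hB (by linarith)
  -- the scaled majorants and their vanishing `L²(a, b)` norms
  have hc : ∀ j, 0 < lam j ^ 2 / ν := fun j => div_pos (pow_pos (hlam j) 2) hν
  have hc0 : Tendsto (fun j => lam j ^ 2 / ν) atTop (𝓝 0) := by
    have h := (hlam0.pow 2).div_const ν
    rw [zero_pow two_ne_zero, zero_div] at h
    exact h
  set H : ℕ → ℝ → ℝ≥0∞ := fun j s => ENNReal.ofReal (lam j) * g (T + lam j ^ 2 / ν * s) with hHdef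
  have hgc : ∀ j, Measurable fun s : ℝ => g (T + lam j ^ 2 / ν * s) := fun j =>
    hgm.comp ((measurable_id.const_mul (lam j ^ 2 / ν)).const_add T)
  have hHm : ∀ j, Measurable (H j) := fun j => (hgc j).const_mul _
  have hH2m : ∀ j, Measurable fun s => H j s ^ 2 := fun j => (hHm j).pow_const 2
  have hInt : ∀ j, ∫⁻ s in Ioo a b, H j s ^ 2 =
      ENNReal.ofReal ν * ∫⁻ t in Ioo (T + lam j ^ 2 / ν * a) (T + lam j ^ 2 / ν * b), g t ^ 2 := by
    intro j
    have e1 : (fun s => H j s ^ 2) =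
        fun s => ENNReal.ofReal (lam j) ^ 2 * g (T + lam j ^ 2 / ν * s) ^ 2 := by
      funext s; simp only [hHdef]; rw [mul_pow]
    have h3 : ∫⁻ s in Ioo a b, g (T + lam j ^ 2 / ν * s) ^ 2 = ENNReal.ofReal (lam j ^ 2 / ν)⁻¹ *
        ∫⁻ t in Ioo (T + lam j ^ 2 / ν * a) (T + lam j ^ 2 / ν * b), g t ^ 2 :=
      setLIntegral_Ioo_comp_add_mul (hc j) T a b (fun t => g t ^ 2)
    have e2 : ENNReal.ofReal (lam j) ^ 2 * ENNReal.ofReal (lam j ^ 2 / ν)⁻¹ = ENNReal.ofReal ν := by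
      rw [← ENNReal.ofReal_pow (hlam j).le, ← ENNReal.ofReal_mul (pow_nonneg (hlam j).le 2)]
      congr 1
      have hl : lam j ^ 2 ≠ 0 := pow_ne_zero 2 (hlam j).ne'
      rw [div_eq_mul_inv, mul_inv, inv_inv, ← mul_assoc, mul_inv_cancel₀ hl, one_mul]
    rw [e1, lintegral_const_mul _ ((hgc j).pow_const 2), h3, ← mul_assoc, e2]
  have hsub : ∀ᶠ j in atTop, Ioo (T + lam j ^ 2 / ν * a) (T + lam j ^ 2 / ν * b) ⊆ Ioo 0 T := by
    have h1 : Tendsto (fun j => lam j ^ 2 / ν * (-a)) atTop (𝓝 (0 * (-a))) := hc0.mul_const _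
    rw [zero_mul] at h1
    filter_upwards [h1.eventually_lt_const hT] with j hj
    intro t ht
    have hb' : lam j ^ 2 / ν * b < 0 := mul_neg_of_pos_of_neg (hc j) hb
    exact ⟨by linarith [ht.1], by linarith [ht.2]⟩
  have hvol : Tendsto (fun j => (volume.restrict (Ioo 0 T))
      (Ioo (T + lam j ^ 2 / ν * a) (T + lam j ^ 2 / ν * b))) atTop (𝓝 0) := by
    have h1 : Tendsto (fun j => ENNReal.ofReal (lam j ^ 2 / ν * (b - a))) atTop
        (𝓝 (ENNReal.ofReal (0 * (b - a)))) := ENNReal.tendsto_ofReal (hc0.mul_const _)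
    rw [zero_mul, ENNReal.ofReal_zero] at h1
    refine tendsto_of_tendsto_of_tendsto_of_le_of_le tendsto_const_nhds h1 (fun _ => zero_le)
      fun j => ?_
    calc (volume.restrict (Ioo 0 T)) (Ioo (T + lam j ^ 2 / ν * a) (T + lam j ^ 2 / ν * b))
        ≤ volume (Ioo (T + lam j ^ 2 / ν * a) (T + lam j ^ 2 / ν * b)) :=
          Measure.le_iff'.1 Measure.restrict_le_self _
      _ = ENNReal.ofReal (lam j ^ 2 / ν * (b - a)) := by
          rw [Real.volume_Ioo]; ring_nf
  have htail : Tendsto (fun j => ∫⁻ t in Ioo (T + lam j ^ 2 / ν * a) (T + lam j ^ 2 / ν * b),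
      g t ^ 2 ∂(volume.restrict (Ioo 0 T))) atTop (𝓝 0) :=
    tendsto_setLIntegral_zero (μ := volume.restrict (Ioo 0 T))
      (s := fun j => Ioo (T + lam j ^ 2 / ν * a) (T + lam j ^ 2 / ν * b)) hg2.ne hvol
  set I : ℕ → ℝ≥0∞ := fun j => ∫⁻ s in Ioo a b, H j s ^ 2 with hIdef
  have hI0 : Tendsto I atTop (𝓝 0) := by
    have h1 : Tendsto (fun j => ENNReal.ofReal ν *
        ∫⁻ t in Ioo (T + lam j ^ 2 / ν * a) (T + lam j ^ 2 / ν * b),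
          g t ^ 2 ∂(volume.restrict (Ioo 0 T))) atTop (𝓝 0) := by
      have h := ENNReal.Tendsto.const_mul (a := ENNReal.ofReal ν) htail (Or.inr ENNReal.ofReal_ne_top)
      rwa [mul_zero] at h
    refine h1.congr' ?_
    filter_upwards [hsub] with j hj
    simp only [hIdef]
    rw [hInt j, Measure.restrict_restrict measurableSet_Ioo, inter_eq_self_of_subset_left hj]
  -- the thresholds `δ_j = I_j/(ℓ/4) + λ_j → 0`
  have hℓ4 : ENNReal.ofReal (ℓ / 4) ≠ 0 := (ENNReal.ofReal_pos.2 (by positivity)).ne'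
  set δ : ℕ → ℝ≥0∞ := fun j => I j / ENNReal.ofReal (ℓ / 4) + ENNReal.ofReal (lam j) with hδdef
  have hδ0 : Tendsto δ atTop (𝓝 0) := by
    have h1 : Tendsto (fun j => I j / ENNReal.ofReal (ℓ / 4)) atTop (𝓝 (0 / ENNReal.ofReal (ℓ / 4))) :=
      ENNReal.Tendsto.div_const hI0 (Or.inr hℓ4)
    rw [ENNReal.zero_div] at h1
    have h2 : Tendsto (fun j => ENNReal.ofReal (lam j)) atTop (𝓝 (ENNReal.ofReal 0)) :=
      ENNReal.tendsto_ofReal hlam0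
    rw [ENNReal.ofReal_zero] at h2
    simpa using h1.add h2
  -- at every large `j` a good slice exists
  have hgood : ∀ᶠ j in atTop, ∃ s, s ∈ Ioo a b ∧ T + lam j ^ 2 / ν * s ∉ E ∧ H j s ^ 2 < δ j := by
    have hsmall : ∀ᶠ j in atTop, lam j ^ 2 / ν * (-a) < h0 := by
      have h1 : Tendsto (fun j => lam j ^ 2 / ν * (-a)) atTop (𝓝 (0 * (-a))) := hc0.mul_const _
      rw [zero_mul] at h1
      exact h1.eventually_lt_const hh0
    have hIfin : ∀ᶠ j in atTop, I j < 1 := hI0.eventually_lt_const one_pos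
    filter_upwards [hsmall, hIfin] with j hsm hIj
    have hItop : I j ≠ ⊤ := (hIj.trans ENNReal.one_lt_top).ne
    by_contra hno
    push Not at hno
    -- (1) Markov: the set where `H_j² ≥ δ_j` has measure `≤ ℓ/4`
    set Bad : Set ℝ := {s | δ j ≤ H j s ^ 2} with hBaddef
    have hBadm : MeasurableSet Bad := measurableSet_le measurable_const (hH2m j)
    have hδ0j : δ j ≠ 0 := by
      simp only [hδdef]
      exact ne_of_gt (lt_of_lt_of_le (ENNReal.ofReal_pos.2 (hlam j)) le_add_self)
    have hδtop : δ j ≠ ⊤ := by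
      simp only [hδdef]
      exact ENNReal.add_ne_top.2 ⟨ENNReal.div_ne_top hItop hℓ4, ENNReal.ofReal_ne_top⟩
    have hMarkov : δ j * volume (Bad ∩ Ioo a b) ≤ I j := by
      have h := mul_meas_ge_le_lintegral₀ (μ := volume.restrict (Ioo a b)) (hH2m j).aemeasurable (δ j)
      rwa [Measure.restrict_apply hBadm] at h
    have hBad : volume (Bad ∩ Ioo a b) ≤ ENNReal.ofReal (ℓ / 4) := by
      by_contra hlt
      push Not at hlt
      have h1 : ENNReal.ofReal (ℓ / 4) * δ j < volume (Bad ∩ Ioo a b) * δ j :=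
        ENNReal.mul_lt_mul_left hδ0j hδtop hlt
      have h2 : I j < ENNReal.ofReal (ℓ / 4) * δ j := by
        simp only [hδdef]
        rw [mul_add, mul_comm (ENNReal.ofReal (ℓ / 4)) (I j / ENNReal.ofReal (ℓ / 4)),
          ENNReal.div_mul_cancel hℓ4 ENNReal.ofReal_ne_top]
        exact ENNReal.lt_add_right hItop (mul_ne_zero hℓ4 (ENNReal.ofReal_pos.2 (hlam j)).ne')
      have h3 : volume (Bad ∩ Ioo a b) * δ j ≤ I j := by rw [mul_comm]; exact hMarkov
      exact absurd ((h2.trans h1).trans_le h3) (lt_irrefl _)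
    -- (2) the good slices are mapped into `E ∩ (T - λ²|a|/ν, T)`: measure `≤ θ'|a|`
    set Good : Set ℝ := Ioo a b ∩ {s | H j s ^ 2 < δ j} with hGooddef
    have hGoodE : Good ⊆ (fun s => lam j ^ 2 / ν * s) ⁻¹'
        ((fun x => T + x) ⁻¹' (E ∩ Ioo (T - lam j ^ 2 / ν * (-a)) T)) := by
      intro s hs
      have hsab : s ∈ Ioo a b := hs.1
      refine ⟨?_, ?_, ?_⟩
      · by_contra hnot
        exact absurd (hno s hsab hnot) (not_le.2 hs.2)
      · show T - lam j ^ 2 / ν * (-a) < T + lam j ^ 2 / ν * s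
        nlinarith [hsab.1, hc j]
      · show T + lam j ^ 2 / ν * s < T
        nlinarith [hsab.2, hc j, hb]
    have hGood : volume Good ≤ ENNReal.ofReal (θ' * (-a)) := by
      refine (measure_mono hGoodE).trans ?_
      rw [Real.volume_preimage_mul_left (hc j).ne', measure_preimage_add]
      calc ENNReal.ofReal |(lam j ^ 2 / ν)⁻¹| * volume (E ∩ Ioo (T - lam j ^ 2 / ν * (-a)) T)
          ≤ ENNReal.ofReal |(lam j ^ 2 / ν)⁻¹| * ENNReal.ofReal (θ' * (lam j ^ 2 / ν * (-a))) :=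
            mul_le_mul' le_rfl (hE' _ (mul_pos (hc j) hma) hsm)
        _ = ENNReal.ofReal (θ' * (-a)) := by
            rw [abs_of_pos (inv_pos.2 (hc j)), ← ENNReal.ofReal_mul (inv_pos.2 (hc j)).le]
            congr 1
            calc (lam j ^ 2 / ν)⁻¹ * (θ' * (lam j ^ 2 / ν * (-a)))
                = ((lam j ^ 2 / ν)⁻¹ * (lam j ^ 2 / ν)) * (θ' * (-a)) := by ring
              _ = θ' * (-a) := by rw [inv_mul_cancel₀ (hc j).ne', one_mul]
    -- (3) but `(a, b) ⊆ Good ∪ (Bad ∩ (a, b))`, and `θ'|a| + ℓ/4 < b - a`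
    have hcover : Ioo a b ⊆ Good ∪ (Bad ∩ Ioo a b) := by
      intro s hs
      by_cases h : H j s ^ 2 < δ j
      · exact Or.inl ⟨hs, h⟩
      · exact Or.inr ⟨not_lt.1 h, hs⟩
    have hmeas : ENNReal.ofReal (b - a) ≤ ENNReal.ofReal (θ' * (-a) + ℓ / 4) := by
      calc ENNReal.ofReal (b - a) = volume (Ioo a b) := (Real.volume_Ioo).symm
        _ ≤ volume Good + volume (Bad ∩ Ioo a b) :=
            (measure_mono hcover).trans (measure_union_le _ _)
        _ ≤ ENNReal.ofReal (θ' * (-a)) + ENNReal.ofReal (ℓ / 4) := add_le_add hGood hBad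
        _ = ENNReal.ofReal (θ' * (-a) + ℓ / 4) :=
            (ENNReal.ofReal_add (mul_nonneg hθ'0 hma.le) (by positivity)).symm
    have hreal : b - a ≤ θ' * (-a) + ℓ / 4 := (ENNReal.ofReal_le_ofReal_iff (by positivity)).1 hmeas
    have : b - a = ℓ + θ' * (-a) := by rw [hℓdef]; ring
    linarith
  -- choose the slices
  set σ : ℕ → ℝ := fun j =>
    if h : ∃ s, s ∈ Ioo a b ∧ T + lam j ^ 2 / ν * s ∉ E ∧ H j s ^ 2 < δ j then h.choose else b
    with hσdef
  refine ⟨a, hab, σ, δ, hδ0, hgood.mono fun j hj => ?_⟩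
  have hσj : σ j = hj.choose := by simp only [hσdef]; rw [dif_pos hj]
  have hspec := hj.choose_spec
  rw [← hσj] at hspec
  exact ⟨hspec.1, hspec.2.1, hspec.2.2.le⟩

end Summit.NavierStokesRegularity.NavierStokesRegularity.Theorems

end
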